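import Summits.HubbardSuperconductivity.HubbardSuperconductivity.Theses.AposterioriCapRg
import Summits.HubbardSuperconductivity.HubbardSuperconductivity.Theorems.SeededBrokenRegimeBoseFermiPinned.Negative.LoadBearing
import Summits.HubbardSuperconductivity.HubbardSuperconductivity.Theorems.AposterioriCapRgSeededBrokenRegimeBoseFermiPinnedLoosenedDatum

/-!
# Post-restatement skeleton (architecture check) — ANCHOR ∧ STEP at a PINNED remainder threshold

Crux-strategist `planner-cstrat-stmt-HubbardSuperconductivity-14047-p1-0`, 2026-08-17.  Companion of `PostRestatementLine.md` and
`RestatementKit.lean`.  PURPOSE: to show, kernel-checked, that the dead line `seed-strength-flow`'s architecture (v5,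
`Lines/seed_strength_flow.lean`) closes the RESTATED crux `SeededBrokenRegimeBoseFermiAbove etaFloor` (RestatementKit §2, restatement
option (α); `etaFloor := 1/4`, the smallest round literal above the D1″ anomalous-block floor incl. the unestimated mixing block —
STRATEGY-CENSUS.md §4) with its two stubs FROZEN at the literal: `stub_anchorFlowAbove` / `stub_seedLoweringAbove` are v5's S4 / S5 with
the remainder threshold frozen and the `∀ etaStar` prefix GONE — which is exactly what removes the standing disprover's floor objection
(`stub_seedLowering_false_of_targetFloorHyp`, `stub_anchorFlow_false_of_anchorFloorHyp` need a threshold `< c`; here `etaFloor/2 = 1/8 > c_W`).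
The composition `above_of_stubs` is v5's `SeededBrokenRegimeBoseFermiPinned_of` verbatim up to the freeze (it never used the universality
of the threshold).  NOT REGISTERED (`skeleton check`) on stmt-14047: its conclusion is the restated decl, which does not exist in the route
until the route-repair lands; a crux-plan seat then re-cuts the two stubs into P1–P4 of the line card.  Sorries ONLY in the two stubs.
-/

set_option linter.dupNamespace false

namespace Summit.HubbardSuperconductivity.HubbardSuperconductivity.Cruxes.SeededBrokenRegimeBoseFermiPinned.Strategist.PostRestatement

open Summit.HubbardSuperconductivity.HubbardSuperconductivity.Theses.AposterioriCapRg
open Summit.HubbardSuperconductivity.HubbardSuperconductivity.Theorems.SeededBrokenRegimeBoseFermiPinned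
open Summit.HubbardSuperconductivity.HubbardSuperconductivity.Theorems
open Literature.MathematicalPhysics.QuantumLattice Literature.Probability.LatticeModels GrassmannAlgebra Filter
open scoped Matrix ComplexConjugate

/-- The pinned remainder threshold of restatement option (α) (route-level literal; `1/4` here). -/
def etaFloor : ℚ := 1 / 4

theorem etaFloor_pos : (0 : ℚ) < etaFloor := by norm_num [etaFloor]

/-- The density clause of the box. -/
def Dens (U μ δ : ℝ) : Prop :=
  Filter.Tendsto (fun L : ℕ => ((hubbardTorusWith 2 (L + 1) 1 U μ).groundStateFunctional
    totalNumber).re / ((L + 1 : ℕ) : ℝ) ^ 2) Filter.atTop (nhds (1 - δ))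

/-- The crux's conclusion at thresholds `(kStar, etaStar)` and the point `(U, μ)`. -/
def Concl (kStar etaStar : ℚ) (U μ : ℝ) : Prop :=
  ∃ h₀ : ℝ, 0 < h₀ ∧ ∃ D : HubbardScaleData, D.MeetsThresholds kStar etaStar ∧ 0 < D.numPatches ∧
    0 < D.meanFieldDensity.fst ∧
    ∀ h ∈ Set.Ioc (0:ℝ) h₀, ∃ L₀' : ℕ, D.IsCertifiedEnclosure (hubbardScaleReportCT U μ D h) L₀'

/-- **The restated crux** (RestatementKit.lean §2, byte-identical): the crux ABOVE the pinned remainder threshold `η₀`. -/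
def SeededBrokenRegimeBoseFermiAbove (η₀ : ℚ) : Prop :=
  ∀ kStar : ℚ, 0 < kStar → ∃ Θ : SymmetricTolerance,
    ∀ U ∈ Set.Icc (2:ℝ) 3, ∀ δ ∈ Set.Icc (1/5:ℝ) (7/20), ∀ μ : ℝ, Dens U μ δ →
      ∀ (K : TrigPolyC4v) (Λ : ℝ) (L₀ : ℕ),
        symmetricRegimeCertificateT U μ capRgCornerDataT Θ K Λ L₀ → Concl kStar η₀ U μ

/-! ### ANCHOR at the pinned threshold (v5 S4 with the remainder threshold frozen) -/

/-- **`stub_anchorFlowAbove`** — v5's S4 frozen at `etaFloor`: for every stiffness threshold a tolerance such that at every certified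
point there is a scale-capped datum meeting `(2·kStar, etaFloor/2)` with gap ratio `20`, `0 < N_p`, `0 < m₀.fst`, CT-realised in model
form at the anchor seed `D.scale/4`.  To be re-cut as P1 ∧ P2 ∧ P3(anchor) of the line card.  XL. -/
theorem stub_anchorFlowAbove :
    ∀ kStar : ℚ, 0 < kStar → ∃ Θ : SymmetricTolerance,
      ∀ U ∈ Set.Icc (2:ℝ) 3, ∀ (μ : ℝ) (K : TrigPolyC4v) (Λ : ℝ) (L₀ : ℕ),
        symmetricRegimeCertificateT U μ capRgCornerDataT Θ K Λ L₀ →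
          ∃ D : HubbardScaleData, (D.scale : ℝ) ≤ Λ * Real.exp (-8) / 30 ∧
            D.MeetsThresholdsWith 20 (2 * kStar) (etaFloor / 2) ∧ 0 < D.numPatches ∧
            0 < D.meanFieldDensity.fst ∧
            ∃ L₁ : ℕ, ∀ L : ℕ, L₁ ≤ L → ∀ [NeZero L], ∃ β₀ : ℝ, ∀ β : ℝ, β₀ ≤ β →
              ∃ K' : TrigPolyC4v, IsAdmissibleFrame K' ∧
                ∃ p : HubbardScaleData.Parameters D.numPatches, D.Encloses p ∧
                  ∀ᶠ M in Filter.atTop,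
                    IsRealisedAtCT L M β U μ ((D.scale : ℝ) / 4) K' (D.scale : ℝ) D.numPatches D.nodal p := by
  sorry


/-! ### STEP at the pinned threshold (v5 S5 with the remainder threshold frozen) -/

/-- **`stub_seedLoweringAbove`** — v5's S5 frozen at `etaFloor`: lowering the seed from the anchor keeps a tuple of the factor-two box
realised at every `h ∈ (0, D.scale/4)`; the box's `p.remainderNorm ≤ 2·D.remainderNorm.snd ≤ etaFloor` is now ABOVE the floor.  To be
re-cut as P3(step) ∧ P4 of the line card.  XL. -/
theorem stub_seedLoweringAbove :
    ∀ kStar : ℚ, 0 < kStar → ∃ Θ : SymmetricTolerance,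
      ∀ U ∈ Set.Icc (2:ℝ) 3, ∀ (μ : ℝ) (K : TrigPolyC4v) (Λ : ℝ) (L₀ : ℕ),
        symmetricRegimeCertificateT U μ capRgCornerDataT Θ K Λ L₀ →
          ∀ D : HubbardScaleData, (D.scale : ℝ) ≤ Λ * Real.exp (-8) / 30 →
            D.MeetsThresholdsWith 20 (2 * kStar) (etaFloor / 2) → 0 < D.numPatches →
            0 < D.meanFieldDensity.fst →
            (∃ L₀' : ℕ, D.IsCertifiedEnclosure (hubbardScaleReportCT U μ D ((D.scale : ℝ) / 4)) L₀') →
              ∀ h ∈ Set.Ioo (0:ℝ) ((D.scale : ℝ) / 4), ∃ L₁ : ℕ, ∀ L : ℕ, L₁ ≤ L → ∀ [NeZero L],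
                ∃ β₀ : ℝ, ∀ β : ℝ, β₀ ≤ β → ∃ K' : TrigPolyC4v, IsAdmissibleFrame K' ∧
                  ∃ p : HubbardScaleData.Parameters D.numPatches,
                    ((∀ i, ((D.gap i).fst : ℝ) - 10 * (D.scale : ℝ) ≤ p.gap i ∧
                          p.gap i ≤ ((D.gap i).snd : ℝ) + 10 * (D.scale : ℝ)) ∧
                        2 / 3 * (D.stiffness.fst : ℝ) ≤ p.stiffness ∧ p.stiffness ≤ 2 * (D.stiffness.snd : ℝ) ∧
                        (D.compressibility.fst : ℝ) / 2 ≤ p.compressibility ∧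
                        p.compressibility ≤ 2 * (D.compressibility.snd : ℝ) ∧
                        (D.fermiVelocity.fst : ℝ) / 2 ≤ p.fermiVelocity ∧
                        p.fermiVelocity ≤ 4 / 3 * (D.fermiVelocity.snd : ℝ) ∧
                        (D.gapVelocity.fst : ℝ) / 2 ≤ p.gapVelocity ∧ p.gapVelocity ≤ 4 / 3 * (D.gapVelocity.snd : ℝ) ∧
                        p.remainderNorm ≤ 2 * (D.remainderNorm.snd : ℝ) ∧
                        (D.meanFieldDensity.fst : ℝ) / 2 ≤ p.meanFieldDensity ∧
                        p.meanFieldDensity ≤ 2 * (D.meanFieldDensity.snd : ℝ)) ∧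
                      ∀ᶠ M in Filter.atTop,
                        IsRealisedAtCT L M β U μ h K' (D.scale : ℝ) D.numPatches D.nodal p := by
  sorry


/-! ### Composition (v5 verbatim up to the freeze; pure logic) -/

/-- The componentwise minimum of two tolerances. -/
def minTol (Θ₁ Θ₂ : SymmetricTolerance) : SymmetricTolerance where
  mismatch := min Θ₁.mismatch Θ₂.mismatch
  mismatch_pos := lt_min Θ₁.mismatch_pos Θ₂.mismatch_pos
  width := min Θ₁.width Θ₂.width
  width_pos := lt_min Θ₁.width_pos Θ₂.width_pos

/-- Model form ⇒ certified enclosure: a datum enclosing, for all `L ≥ L₁` (`L ≥ 1`) and `β ≥ β₀(L)`, a tuple realised in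
one admissible frame for all large `M`, is a certified enclosure of the CT report from `max L₁ 1` on. -/
theorem isCertifiedEnclosure_of_eventually {U μ h : ℝ} (D : HubbardScaleData) {L₁ : ℕ}
    (hreal : ∀ L : ℕ, L₁ ≤ L → ∀ [NeZero L], ∃ β₀ : ℝ, ∀ β : ℝ, β₀ ≤ β →
      ∃ K' : TrigPolyC4v, IsAdmissibleFrame K' ∧ ∃ p : HubbardScaleData.Parameters D.numPatches, D.Encloses p ∧
        ∀ᶠ M in Filter.atTop, IsRealisedAtCT L M β U μ h K' (D.scale : ℝ) D.numPatches D.nodal p) :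
    D.IsCertifiedEnclosure (hubbardScaleReportCT U μ D h) (max L₁ 1) := by
  intro L hL
  haveI : NeZero L := ⟨by omega⟩
  obtain ⟨β₀, hβ₀⟩ := hreal L (le_of_max_le_left hL)
  refine ⟨β₀, fun β hβ => ?_⟩
  obtain ⟨K', hK', p, hDp, hp⟩ := hβ₀ β hβ
  exact ⟨p, by rw [hubbardScaleReportCT_eq]; exact mem_hubbardScaleReportCTAt_of_eventually hK' hp, hDp⟩

/-- **The line closes the RESTATED crux**: ANCHOR and STEP at the pinned remainder threshold give
`SeededBrokenRegimeBoseFermiAbove etaFloor`, via the landed loosening S7 (v5 composition verbatim, remainder threshold frozen). -/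
theorem above_of_stubs : SeededBrokenRegimeBoseFermiAbove etaFloor := by
  intro kStar hk
  have he : (0 : ℚ) < etaFloor := etaFloor_pos
  obtain ⟨ΘA, hA⟩ := stub_anchorFlowAbove kStar hk
  obtain ⟨ΘS, hS⟩ := stub_seedLoweringAbove kStar hk
  refine ⟨minTol ΘA ΘS, ?_⟩
  intro U hU δ _hδ μ _hdens K Λ L₀ hcert
  have hcA : symmetricRegimeCertificateT U μ capRgCornerDataT ΘA K Λ L₀ :=
    Negative.certificateT_mono_tol (min_le_left _ _) (min_le_left _ _) hcert
  have hcS : symmetricRegimeCertificateT U μ capRgCornerDataT ΘS K Λ L₀ :=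
    Negative.certificateT_mono_tol (min_le_right _ _) (min_le_right _ _) hcert
  obtain ⟨D, hcap, hmeets, hNp, hm, L₁, hanchor⟩ := hA U hU μ K Λ L₀ hcA
  -- the anchor enclosure in certified form (input of STEP)
  have hanchorCert : ∃ L₀' : ℕ, D.IsCertifiedEnclosure (hubbardScaleReportCT U μ D ((D.scale : ℝ) / 4)) L₀' :=
    ⟨max L₁ 1, isCertifiedEnclosure_of_eventually D hanchor⟩
  have hstep := hS U hU μ K Λ L₀ hcS D hcap hmeets hNp hm hanchorCert
  -- loosen the datum (S7, landed)
  obtain ⟨gap', ρ', κ', vF', vΔ', η', m₀', hmeets', hm₀', hencl, hbox⟩ :=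
    AposterioriCapRgSeededBrokenRegimeBoseFermiPinned.stub_loosenedDatum D kStar etaFloor hk he hmeets hm
  set D' : HubbardScaleData := HubbardScaleData.mk D.scale D.scale_pos D.numPatches D.nodal gap' ρ' κ' vF' vΔ' η' m₀'
    with hD'
  have hΛpos : (0 : ℝ) < (D.scale : ℝ) := D.cast_scale_pos
  refine ⟨(D.scale : ℝ) / 4, by positivity, D', hmeets', hNp, hm₀', ?_⟩
  intro h hh
  rcases lt_or_eq_of_le hh.2 with hlt | heq
  · -- `h < h₀`: the box tuple of STEP, enclosed by `D'`
    obtain ⟨L₂, hL₂⟩ := hstep h ⟨hh.1, hlt⟩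
    refine ⟨max L₂ 1, ?_⟩
    intro L hL
    haveI : NeZero L := ⟨by omega⟩
    obtain ⟨β₀, hβ₀⟩ := hL₂ L (le_of_max_le_left hL)
    refine ⟨β₀, fun β hβ => ?_⟩
    obtain ⟨K', hK', p, hpbox, hp⟩ := hβ₀ β hβ
    have hη0 : 0 ≤ p.remainderNorm := by
      obtain ⟨M, hM⟩ := hp.exists
      exact hM.remainderNorm_nonneg hΛpos.le
    refine ⟨p, ?_, hbox p hη0 hpbox⟩
    show p ∈ hubbardScaleReportCTAt U μ h (D.scale : ℝ) D.numPatches D.nodal L β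
    exact mem_hubbardScaleReportCTAt_of_eventually hK' hp
  · -- `h = h₀`: the anchor tuple itself, enclosed by `D` hence by `D'`
    subst heq
    refine ⟨max L₁ 1, ?_⟩
    intro L hL
    haveI : NeZero L := ⟨by omega⟩
    obtain ⟨β₀, hβ₀⟩ := hanchor L (le_of_max_le_left hL)
    refine ⟨β₀, fun β hβ => ?_⟩
    obtain ⟨K', hK', p, hDp, hp⟩ := hβ₀ β hβ
    refine ⟨p, ?_, hencl p hDp⟩
    show p ∈ hubbardScaleReportCTAt U μ ((D.scale : ℝ) / 4) (D.scale : ℝ) D.numPatches D.nodal L β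
    exact mem_hubbardScaleReportCTAt_of_eventually hK' hp

end Summit.HubbardSuperconductivity.HubbardSuperconductivity.Cruxes.SeededBrokenRegimeBoseFermiPinned.Strategist.PostRestatement
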